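import Literature.Barriers.CriticalPhenomena.PlaquetteWalkAngleLimitAntipode
import HarnessLib

/-!
# Barrier catalogue (SAWScalingLimit): a finite sum of limit weights drawn from an ANTIPODE-FREE three/four-phase set vanishes iff it is empty
(«ANTIPODE-FREE PHASES: THE ASSEMBLY LEMMA»)

Companion of `PlaquetteWalkAngleLimitAntipode` (`sum_phases_above_eq_zero_iff`, `sum_phases_below_eq_zero_iff`: the phase sets `{1,2,4,7}` and `{0,2,5,7}` of the
hole-column census law cannot cancel) in the form the ASSEMBLY of the hole-column law consumes: the member theorems
(`PlaquetteWalkHoleRootHoleColumn{LimitWeight, PhasesBelow, Adjacent, AdjacentLaw}`) say that every level-`7` wound member `ω` at a hole-column cell has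
`limitWeight = c · ζ^{4k}` with `c = (√2)⁷` and `k ∈ {1,2,4,7}` above the hole (`ζ⁴, ζ⁸, ζ¹⁶, ζ²⁸`), `k ∈ {0,2,5,7}` below (`1, ζ⁸, ζ²⁰, ζ²⁸`); here, for ANY finite
index set and any `c ≠ 0`:

* ★★ `sum_eq_of_mem_phases_above` / `_below` — such a sum is `c · (N₁ζ⁴ + N₂ζ⁸ + N₄ζ¹⁶ + N₇ζ²⁸)` (resp. `c · (N₀ + N₂ζ⁸ + N₅ζ²⁰ + N₇ζ²⁸)`) with natural
  multiplicities adding up to the number of terms;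
* ★★★ `sum_eq_zero_iff_of_mem_phases_above` / `_below` — **the sum vanishes iff the index set is empty**; `sum_ne_zero_of_mem_phases_above` / `_below` — a
  non-empty sum is non-zero. With `c = (√2)⁷` (`sqrt_two_pow_seven_ne_zero`) this is the last step of «`Λ₇ ≠ 0` at a hole-column cell ⟺ a level-`7` member
  exists» once every member's phase is known to lie in the set.

Elementary (cyclotomic coordinates, `PlaquetteWalkAngleLimitAntipode`). [GlazmanManolescu2019 §1 eq. (1), Lemma 2.1 (the `Z → ∞` bookkeeping is lane plumbing)]
-/

noncomputable section

namespace Literature.Barriers.CriticalPhenomena.PlaquetteWalk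

open Complex

/-- `(√2)⁷ ≠ 0` in `ℂ` (the common magnitude of the level-`7` limit weights). [cite: GlazmanManolescu2019, §1, eq. (1) (lane plumbing)] -/
theorem sqrt_two_pow_seven_ne_zero : ((Real.sqrt 2 : ℝ) : ℂ) ^ 7 ≠ 0 := by
  apply pow_ne_zero
  rw [Ne, Complex.ofReal_eq_zero]
  exact Real.sqrt_ne_zero'.2 two_pos

/-! ## Above the hole: phases `ζ⁴, ζ⁸, ζ¹⁶, ζ²⁸` -/

/-- ★★ **A sum of terms from `{cζ⁴, cζ⁸, cζ¹⁶, cζ²⁸}` is `c · (N₁ζ⁴ + N₂ζ⁸ + N₄ζ¹⁶ + N₇ζ²⁸)`** with natural multiplicities `N₁ + N₂ + N₄ + N₇ = #s`.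
[cite: GlazmanManolescu2019, §1, eq. (1) (lane plumbing)] -/
theorem sum_eq_of_mem_phases_above {ι : Type*} (s : Finset ι) (f : ι → ℂ) (c : ℂ)
    (hf : ∀ i ∈ s, f i = c * zeta32 ^ 4 ∨ f i = c * zeta32 ^ 8 ∨ f i = c * zeta32 ^ 16 ∨ f i = c * zeta32 ^ 28) :
    ∃ N₁ N₂ N₄ N₇ : ℕ, N₁ + N₂ + N₄ + N₇ = s.card ∧
      ∑ i ∈ s, f i = c * ((N₁ : ℂ) * zeta32 ^ 4 + N₂ * zeta32 ^ 8 + N₄ * zeta32 ^ 16 + N₇ * zeta32 ^ 28) := by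
  classical
  induction s using Finset.induction_on with
  | empty => exact ⟨0, 0, 0, 0, by simp, by simp⟩
  | insert a s ha ih =>
    obtain ⟨N₁, N₂, N₄, N₇, hN, hsum⟩ := ih (fun i hi => hf i (Finset.mem_insert_of_mem hi))
    rw [Finset.sum_insert ha, hsum, Finset.card_insert_of_notMem ha]
    rcases hf a (Finset.mem_insert_self a s) with h | h | h | h <;> rw [h]
    · exact ⟨N₁ + 1, N₂, N₄, N₇, by omega, by push_cast; ring⟩
    · exact ⟨N₁, N₂ + 1, N₄, N₇, by omega, by push_cast; ring⟩
    · exact ⟨N₁, N₂, N₄ + 1, N₇, by omega, by push_cast; ring⟩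
    · exact ⟨N₁, N₂, N₄, N₇ + 1, by omega, by push_cast; ring⟩

/-- ★★★ **ABOVE THE HOLE: THE SUM VANISHES IFF IT IS EMPTY.** For `c ≠ 0`, a finite sum of terms each in `{cζ⁴, cζ⁸, cζ¹⁶, cζ²⁸}` (phases `1, 2, 4, 7`) is `0` iff
the index set is empty (`sum_phases_above_eq_zero_iff`). [cite: GlazmanManolescu2019, §1, eq. (1) and Lemma 2.1 (lane plumbing: the `Z → ∞` phase sum)] -/
theorem sum_eq_zero_iff_of_mem_phases_above {ι : Type*} (s : Finset ι) (f : ι → ℂ) {c : ℂ} (hc : c ≠ 0)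
    (hf : ∀ i ∈ s, f i = c * zeta32 ^ 4 ∨ f i = c * zeta32 ^ 8 ∨ f i = c * zeta32 ^ 16 ∨ f i = c * zeta32 ^ 28) :
    ∑ i ∈ s, f i = 0 ↔ s = ∅ := by
  obtain ⟨N₁, N₂, N₄, N₇, hN, hsum⟩ := sum_eq_of_mem_phases_above s f c hf
  have key := sum_phases_above_eq_zero_iff N₁ N₂ N₄ N₇
  push_cast at key
  rw [hsum, mul_eq_zero, or_iff_right hc, key, ← Finset.card_eq_zero]
  omega

/-- ★★★ **ABOVE THE HOLE: A NON-EMPTY SUM IS NON-ZERO.** [cite: GlazmanManolescu2019, §1, eq. (1) and Lemma 2.1 (lane plumbing)] -/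
theorem sum_ne_zero_of_mem_phases_above {ι : Type*} {s : Finset ι} (f : ι → ℂ) {c : ℂ} (hc : c ≠ 0)
    (hf : ∀ i ∈ s, f i = c * zeta32 ^ 4 ∨ f i = c * zeta32 ^ 8 ∨ f i = c * zeta32 ^ 16 ∨ f i = c * zeta32 ^ 28) (hs : s.Nonempty) :
    ∑ i ∈ s, f i ≠ 0 := by
  rw [Ne, sum_eq_zero_iff_of_mem_phases_above s f hc hf]
  exact hs.ne_empty

/-! ## Below the hole: phases `1, ζ⁸, ζ²⁰, ζ²⁸` -/

/-- ★★ **A sum of terms from `{c, cζ⁸, cζ²⁰, cζ²⁸}` is `c · (N₀ + N₂ζ⁸ + N₅ζ²⁰ + N₇ζ²⁸)`** with `N₀ + N₂ + N₅ + N₇ = #s`.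
[cite: GlazmanManolescu2019, §1, eq. (1) (lane plumbing)] -/
theorem sum_eq_of_mem_phases_below {ι : Type*} (s : Finset ι) (f : ι → ℂ) (c : ℂ)
    (hf : ∀ i ∈ s, f i = c ∨ f i = c * zeta32 ^ 8 ∨ f i = c * zeta32 ^ 20 ∨ f i = c * zeta32 ^ 28) :
    ∃ N₀ N₂ N₅ N₇ : ℕ, N₀ + N₂ + N₅ + N₇ = s.card ∧
      ∑ i ∈ s, f i = c * ((N₀ : ℂ) + N₂ * zeta32 ^ 8 + N₅ * zeta32 ^ 20 + N₇ * zeta32 ^ 28) := by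
  classical
  induction s using Finset.induction_on with
  | empty => exact ⟨0, 0, 0, 0, by simp, by simp⟩
  | insert a s ha ih =>
    obtain ⟨N₀, N₂, N₅, N₇, hN, hsum⟩ := ih (fun i hi => hf i (Finset.mem_insert_of_mem hi))
    rw [Finset.sum_insert ha, hsum, Finset.card_insert_of_notMem ha]
    rcases hf a (Finset.mem_insert_self a s) with h | h | h | h <;> rw [h]
    · exact ⟨N₀ + 1, N₂, N₅, N₇, by omega, by push_cast; ring⟩
    · exact ⟨N₀, N₂ + 1, N₅, N₇, by omega, by push_cast; ring⟩
    · exact ⟨N₀, N₂, N₅ + 1, N₇, by omega, by push_cast; ring⟩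
    · exact ⟨N₀, N₂, N₅, N₇ + 1, by omega, by push_cast; ring⟩

/-- ★★★ **BELOW THE HOLE: THE SUM VANISHES IFF IT IS EMPTY.** For `c ≠ 0`, a finite sum of terms each in `{c, cζ⁸, cζ²⁰, cζ²⁸}` (phases `0, 2, 5, 7`) is `0` iff the
index set is empty (`sum_phases_below_eq_zero_iff`). [cite: GlazmanManolescu2019, §1, eq. (1) and Lemma 2.1 (lane plumbing: the `Z → ∞` phase sum)] -/
theorem sum_eq_zero_iff_of_mem_phases_below {ι : Type*} (s : Finset ι) (f : ι → ℂ) {c : ℂ} (hc : c ≠ 0)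
    (hf : ∀ i ∈ s, f i = c ∨ f i = c * zeta32 ^ 8 ∨ f i = c * zeta32 ^ 20 ∨ f i = c * zeta32 ^ 28) :
    ∑ i ∈ s, f i = 0 ↔ s = ∅ := by
  obtain ⟨N₀, N₂, N₅, N₇, hN, hsum⟩ := sum_eq_of_mem_phases_below s f c hf
  have key := sum_phases_below_eq_zero_iff N₀ N₂ N₅ N₇
  push_cast at key
  rw [hsum, mul_eq_zero, or_iff_right hc, key, ← Finset.card_eq_zero]
  omega

/-- ★★★ **BELOW THE HOLE: A NON-EMPTY SUM IS NON-ZERO.** [cite: GlazmanManolescu2019, §1, eq. (1) and Lemma 2.1 (lane plumbing)] -/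
theorem sum_ne_zero_of_mem_phases_below {ι : Type*} {s : Finset ι} (f : ι → ℂ) {c : ℂ} (hc : c ≠ 0)
    (hf : ∀ i ∈ s, f i = c ∨ f i = c * zeta32 ^ 8 ∨ f i = c * zeta32 ^ 20 ∨ f i = c * zeta32 ^ 28) (hs : s.Nonempty) :
    ∑ i ∈ s, f i ≠ 0 := by
  rw [Ne, sum_eq_zero_iff_of_mem_phases_below s f hc hf]
  exact hs.ne_empty

end Literature.Barriers.CriticalPhenomena.PlaquetteWalk
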